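import Literature.NumberTheory.IwasawaTheory.Greenberg2006.CofiniteGenerationCriterion
import Literature.NumberTheory.EllipticCurves.IwasawaEulerCharDualityProofs
import HarnessLib

/-!
# Greenberg 2006, Props. 4.1 / 4.2: the Euler–Poincaré `Λ`-CORANK formula from the finite-module
# Euler characteristic — the induction on the Krull dimension ("specialisation to Krull dimension 1")

Topic `NumberTheory/IwasawaTheory/Greenberg2006`; namespace
`Literature.NumberTheory.IwasawaTheory.Greenberg2006`.  THEOREMS ONLY (no definition, no named
fact, no `sorry`, no instance).

Greenberg, *On the structure of certain Galois cohomology groups* (Doc. Math. 2006), §4 A, proves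
the `Λ`-corank formulas Prop. 4.1 (global, `Σ_{i=0}^{2} (−1)^i corank_Λ Hⁱ(K_Σ/K, 𝒟) = −δ_Λ(K,𝒟)`)
and Prop. 4.2 (local, `= −m[K_v : ℚ_p]` resp. `0`) on p. 368: "One can prove these by specialisation
… reducing to the case where `Λ` has Krull dimension 1 … and then to the case where `𝒟` is finite,
where the formulas are those of Poitou–Tate [and Tate]."  This file is that reduction, for an
ABSTRACT compact group `Γ` and an abstract constant `c`, as one theorem
**`corankEuler_of_step_of_finiteEuler`**:

* INPUT (S) — the ONE-PRIME SPECIALISATION STEP, as a hypothesis schema `hstep`: for every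
  `Λ ≅ ℤ_p⟦T₁,…,T_j⟧`, every non-zero prime element `T` of `Λ` and every discrete `p`-primary
  `Λ[Γ]`-module `D` with finitely generated Pontryagin dual (Mathlib `CharacterModule D`), there is a
  discrete `p`-primary `(Λ/T)[Γ]`-module `D′` with finitely generated dual such that
  `Σ_{i≤2} (−1)^i rank_Λ Hⁱ(Γ, D)^∨ = Σ_{i≤2} (−1)^i rank_{Λ/T} Hⁱ(Γ, D′)^∨` and
  `rank_Λ D^∨ = rank_{Λ/T} D′^∨` (in print `D′ = (T^k D)[T]` for `k ≫ 0`; this is the cohomological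
  dévissage `0 → Hⁱ⁻¹(D′)/T → Hⁱ(D′[T]) → Hⁱ(D′)[T] → 0` plus Greenberg's rank specialisation
  Prop. 2.1 / Rem. 2.1.3 — supplied by the sibling engine file, NOT here);
* INPUT (F) — finiteness of `Hⁿ(Γ, A)` for finite discrete modules `A` killed by `p` (Greenberg's
  standing hypothesis §3 p. 358 L8–13);
* INPUT (E) — the FINITE-MODULE Euler characteristic with constant `c`:
  `#H⁰(Γ, A) · #H²(Γ, A) · #A^c = #H¹(Γ, A)` for every finite discrete `Λ[Γ]`-module `A` killed by
  `p` (Tate's local formula I.2.8 with `c = [K_v : ℚ_p]` resp. `0`; Tate's global formula I.5.1 over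
  a totally imaginary `K` with `c = r₂` — the tree's `EPCTate.localEulerPoincare`,
  `GaloisCohomology.natCard_H_euler_of_forall_isComplex`);
* OUTPUT — for every `Λ` with `Λ ≃+* ℤ_p⟦T₁,…,T_m⟧` and every discrete `p`-primary cofinitely
  generated `Λ[Γ]`-module `𝒟`: `h₀ − h₁ + h₂ = −c·m` for all corank witnesses
  (`Greenberg2016.HasCorank`), i.e. the common shape of the named facts
  `prop41_globalEulerPoincareCorank` / `prop42_localEulerPoincareCorank`.

PROOF: induction on `m` along the last variable (`Λ ≅ ℤ_p⟦T₁,…,T_{m+1}⟧ ≅ (ℤ_p⟦T₁,…,T_m⟧)⟦X⟧`,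
`T = X`, `Λ/T ≅ ℤ_p⟦T₁,…,T_m⟧`: the tree's `mvPowerSeriesFinSuccEquiv`), then at `m = 0`
(`Λ ≅ ℤ_p`, `mvPowerSeriesFinZeroEquiv`) one more step with `T = p` to the FIELD `Λ/p ≅ 𝔽_p`
(`PadicInt.residueField`), where a cofinitely generated module is finite, `rank = dim`, and (E) read
in `𝔽_p`-dimensions (`#X = q^{dim X}`, `#X^∨ = #X`) is the claim (`euler_of_isField`).

## References
* R. Greenberg, *On the structure of certain Galois cohomology groups*, Doc. Math. Extra Vol.
  Coates (2006) 335–391, §4 A Props. 4.1, 4.2 (p. 367 L40 – p. 368 L22) and their proof (p. 368);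
  §2 A Prop. 2.1 / Rem. 2.1.3. [Greenberg2006]
* J. S. Milne, *Arithmetic Duality Theorems*, 2nd ed. (2006), I Thm. 2.8, I Thm. 5.1. [MilneADT2006]
-/

noncomputable section

open scoped Classical
open IsLocalRing
open Literature.NumberTheory.GaloisRepresentations
open Literature.NumberTheory.GaloisRepresentations.NearlyOrdinaryPresentationCA
  (mvPowerSeriesFinSuccEquiv mvPowerSeriesFinZeroEquiv)
open Literature.NumberTheory.IwasawaTheory.Greenberg2016
open Literature.NumberTheory.EllipticCurves (PontryaginCard.natCard_characterModule_of_finite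
  PontryaginCard.finite_of_finite_characterModule)

namespace Literature.NumberTheory.IwasawaTheory.Greenberg2006

variable {Γ : Type} [Group Γ] [TopologicalSpace Γ] [IsTopologicalGroup Γ]
variable (p : ℕ) [Fact p.Prime] (c : ℕ)

/-! ### §1. Ring lemmas: the last variable of `ℤ_p⟦T₁,…,T_{m+1}⟧`, and `ℤ_p/p = 𝔽_p` -/

section Rings

variable {Λ : Type} [CommRing Λ]

omit [Fact p.Prime] in
/-- The kernel of the constant-coefficient map `A⟦X⟧ → A` is `(X)`. [folklore] -/
private theorem ker_constantCoeff_eq_span_X (A : Type) [CommRing A] :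
    RingHom.ker (PowerSeries.constantCoeff (R := A)) = Ideal.span {PowerSeries.X} := by
  ext φ
  rw [RingHom.mem_ker, Ideal.mem_span_singleton, PowerSeries.X_dvd_iff]

/-- **The last variable**: if `Λ ≅ ℤ_p⟦T₁,…,T_{m+1}⟧` there is a non-zero prime element `T ∈ Λ`
with `Λ/(T) ≅ ℤ_p⟦T₁,…,T_m⟧` (`Λ ≅ (ℤ_p⟦T₁,…,T_m⟧)⟦X⟧`, `T ↦ X`, `A⟦X⟧/(X) ≅ A`).
[cite: Greenberg2006, §4 A (proof of Props. 4.1/4.2, p. 368: "reducing to the case where `Λ` has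
Krull dimension 1")] -/
theorem exists_prime_quotient_ringEquiv_mvPowerSeries {m : ℕ}
    (e : Λ ≃+* MvPowerSeries (Fin (m + 1)) ℤ_[p]) :
    ∃ T : Λ, T ≠ 0 ∧ Prime T ∧
      Nonempty ((Λ ⧸ Ideal.span {T}) ≃+* MvPowerSeries (Fin m) ℤ_[p]) := by
  set A := MvPowerSeries (Fin m) ℤ_[p] with hA
  haveI : IsDomain A := NoZeroDivisors.to_isDomain _
  let φ : Λ ≃+* PowerSeries A := e.trans (mvPowerSeriesFinSuccEquiv ℤ_[p] m)
  refine ⟨φ.symm PowerSeries.X, ?_, ?_, ?_⟩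
  · intro h
    have : (PowerSeries.X : PowerSeries A) = 0 := by
      have h' := congrArg φ h
      rwa [RingEquiv.apply_symm_apply, map_zero] at h'
    exact PowerSeries.X_ne_zero this
  · exact (MulEquiv.prime_iff φ).1 (by rw [RingEquiv.apply_symm_apply]; exact PowerSeries.X_prime)
  · have hmap : Ideal.span {(PowerSeries.X : PowerSeries A)} =
        Ideal.map (φ : Λ →+* PowerSeries A) (Ideal.span {φ.symm PowerSeries.X}) := by
      rw [Ideal.map_span, Set.image_singleton]
      simp
    refine ⟨(Ideal.quotientEquiv (Ideal.span {φ.symm PowerSeries.X}) (Ideal.span {PowerSeries.X})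
      φ hmap).trans ((Ideal.quotEquivOfEq (ker_constantCoeff_eq_span_X A).symm).trans
        (RingHom.quotientKerEquivOfSurjective PowerSeries.constantCoeff_surj))⟩

/-- **`ℤ_p/p = 𝔽_p`**: if `Λ ≅ ℤ_p⟦⟧ = ℤ_p` (no variables) then `p ∈ Λ` is a non-zero prime element
and `Λ/(p)` is a finite field (`≅ ℤ/p`) in which `p = 0`.
[cite: Greenberg2006, §4 A (proof of Props. 4.1/4.2, p. 368: "and then to the case where `𝒟` is
finite")] -/
theorem prime_natCast_and_isField_quotient_of_ringEquiv_mvPowerSeries_zero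
    (e : Λ ≃+* MvPowerSeries (Fin 0) ℤ_[p]) :
    (p : Λ) ≠ 0 ∧ Prime (p : Λ) ∧ IsField (Λ ⧸ Ideal.span {(p : Λ)}) ∧
      Finite (Λ ⧸ Ideal.span {(p : Λ)}) := by
  let ψ : Λ ≃+* ℤ_[p] := e.trans (mvPowerSeriesFinZeroEquiv ℤ_[p])
  have hψp : ψ (p : Λ) = (p : ℤ_[p]) := map_natCast ψ p
  have hprime : Prime (p : Λ) := (MulEquiv.prime_iff ψ).1 (by rw [hψp]; exact PadicInt.prime_p)
  have hmap : Ideal.span {(p : ℤ_[p])} = Ideal.map (ψ : Λ →+* ℤ_[p]) (Ideal.span {(p : Λ)}) := by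
    rw [Ideal.map_span, Set.image_singleton]
    simp
  let θ : (Λ ⧸ Ideal.span {(p : Λ)}) ≃+* ZMod p :=
    ((Ideal.quotientEquiv _ _ ψ hmap).trans
      (Ideal.quotEquivOfEq (PadicInt.maximalIdeal_eq_span_p (p := p)).symm)).trans
      PadicInt.residueField
  exact ⟨hprime.ne_zero, hprime, MulEquiv.isField (Field.toIsField (ZMod p)) θ.toMulEquiv,
    Finite.of_equiv _ θ.symm.toEquiv⟩

end Rings

/-! ### §2. The finite (field-coefficient) case: `rank = dim` and the Euler identity in dimensions -/

section Field

variable {k : Type} [CommRing k]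

omit [Fact p.Prime] in
/-- Over a finite field, `#X = #k^{dim X}` for a finite `k`-module `X`, and the same for its
Pontryagin dual (`#X^∨ = #X`): hence **`rank_k X^∨ = dim_k X`**. [folklore] -/
private theorem finrank_characterModule_eq_of_isField [Finite k] (hk : IsField k)
    (X : Type) [AddCommGroup X] [Module k X] [Finite X] :
    Module.finrank k (CharacterModule X) = Module.finrank k X := by
  letI : Field k := hk.toField
  haveI : Module.Finite k X := Module.Finite.of_finite
  haveI : Finite (CharacterModule X) :=
    Nat.finite_of_card_ne_zero
      ((PontryaginCard.natCard_characterModule_of_finite X).symm ▸ (Nat.card_pos (α := X)).ne')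
  haveI : Module.Finite k (CharacterModule X) := Module.Finite.of_finite
  have h1 : Nat.card (CharacterModule X) = Nat.card k ^ Module.finrank k (CharacterModule X) :=
    Module.natCard_eq_pow_finrank
  have h2 : Nat.card X = Nat.card k ^ Module.finrank k X := Module.natCard_eq_pow_finrank
  rw [PontryaginCard.natCard_characterModule_of_finite X, h2] at h1
  exact (Nat.pow_right_injective (Finite.one_lt_card (α := k)) h1).symm

omit [Fact p.Prime] in
/-- **The finite case of the corank formula.** Over a FINITE FIELD `k` of characteristic `p` (in
print `Λ/𝔪 = 𝔽_p`), a discrete `k[Γ]`-module `D` with finitely generated dual is finite, its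
cohomology groups are finite (hypothesis (F)) `k`-vector spaces, and the finite-module Euler
characteristic (E) `#H⁰·#H²·#D^c = #H¹`, read in `k`-dimensions (`#X = #k^{dim X}`,
`rank_k X^∨ = dim_k X`), is `rank H⁰^∨ − rank H¹^∨ + rank H²^∨ = −c · rank D^∨`.
[cite: Greenberg2006, §4 A (proof of Props. 4.1/4.2, p. 368)] [cite: MilneADT2006, I Thm. 2.8 and
I Thm. 5.1] -/
theorem euler_of_isField [TopologicalSpace k] [Finite k] (hk : IsField k) (hpk : (p : k) = 0)
    (hFin : ∀ (A : Type) [AddCommGroup A] [Module k A] [TopologicalSpace A] [DiscreteTopology A]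
      [ContinuousSMul k A] [Finite A] (τ : ContinuousRep Γ k A),
      (∀ a : A, (p : k) • a = 0) → ∀ n : ℕ, Finite (τ.H n))
    (hEuler : ∀ (A : Type) [AddCommGroup A] [Module k A] [TopologicalSpace A] [DiscreteTopology A]
      [ContinuousSMul k A] [Finite A] (τ : ContinuousRep Γ k A),
      (∀ a : A, (p : k) • a = 0) →
        Nat.card (τ.H 0) * Nat.card (τ.H 2) * Nat.card A ^ c = Nat.card (τ.H 1))
    {D : Type} [AddCommGroup D] [Module k D] [TopologicalSpace D] [DiscreteTopology D]
    [ContinuousSMul k D] (ρ : ContinuousRep Γ k D) (hD : Module.Finite k (CharacterModule D)) :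
    (Module.finrank k (CharacterModule (ρ.H 0)) : ℤ) - Module.finrank k (CharacterModule (ρ.H 1)) +
        Module.finrank k (CharacterModule (ρ.H 2)) =
      -((c : ℤ) * Module.finrank k (CharacterModule D)) := by
  -- `D` is finite: its dual is a finitely generated module over the finite ring `k`
  haveI : Finite (CharacterModule D) := Module.finite_of_finite k
  haveI : Finite D := PontryaginCard.finite_of_finite_characterModule D
  have hpD : ∀ d : D, (p : k) • d = 0 := fun d => by rw [hpk, zero_smul]
  haveI h0 : Finite (ρ.H 0) := hFin D ρ hpD 0
  haveI h1 : Finite (ρ.H 1) := hFin D ρ hpD 1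
  haveI h2 : Finite (ρ.H 2) := hFin D ρ hpD 2
  have hE := hEuler D ρ hpD
  letI : Field k := hk.toField
  haveI : Module.Finite k (ρ.H 0) := Module.Finite.of_finite
  haveI : Module.Finite k (ρ.H 1) := Module.Finite.of_finite
  haveI : Module.Finite k (ρ.H 2) := Module.Finite.of_finite
  haveI : Module.Finite k D := Module.Finite.of_finite
  rw [Module.natCard_eq_pow_finrank (K := k) (V := ρ.H 0),
    Module.natCard_eq_pow_finrank (K := k) (V := ρ.H 1),
    Module.natCard_eq_pow_finrank (K := k) (V := ρ.H 2),
    Module.natCard_eq_pow_finrank (K := k) (V := D), ← pow_mul, ← pow_add, ← pow_add] at hE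
  have hexp := Nat.pow_right_injective (Finite.one_lt_card (α := k)) hE
  rw [finrank_characterModule_eq_of_isField hk, finrank_characterModule_eq_of_isField hk,
    finrank_characterModule_eq_of_isField hk, finrank_characterModule_eq_of_isField hk]
  have hz : ((Module.finrank k (ρ.H 0) : ℤ) + Module.finrank k (ρ.H 2) +
      Module.finrank k D * c) = Module.finrank k (ρ.H 1) := by exact_mod_cast hexp
  linarith

end Field

/-! ### §3. The induction on the number of variables -/

section Induction

/-- **The Euler–Poincaré corank formula from the one-prime specialisation step and the finite
Euler characteristic — induction on the Krull dimension** (the common proof of Greenberg 2006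
Props. 4.1 and 4.2, p. 368), in the currency `rank_Λ X^∨ = finrank Λ (CharacterModule X)`: for
every `Λ ≃+* ℤ_p⟦T₁,…,T_m⟧` and every discrete `p`-primary `Λ[Γ]`-module `D` with finitely generated
dual, `rank H⁰(Γ,D)^∨ − rank H¹(Γ,D)^∨ + rank H²(Γ,D)^∨ = −c · rank D^∨`.  Hypotheses: `hstep` = (S)
(for all `Λ ≅ ℤ_p⟦T₁,…,T_j⟧`, all non-zero primes `T`), `hFin` = (F) and `hEuler` = (E) (for all
coefficient rings `R` — only finiteness / cardinalities are asserted, which do not see `R`).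
[cite: Greenberg2006, §4 A Props. 4.1, 4.2 and their proof (p. 367 L40 – p. 368 L22)] -/
theorem finrank_euler_of_step_of_finiteEuler
    (hstep : ∀ (j : ℕ) (Λ : Type) [CommRing Λ] [TopologicalSpace Λ] [IsTopologicalRing Λ],
      (Λ ≃+* MvPowerSeries (Fin j) ℤ_[p]) → ∀ (T : Λ), T ≠ 0 → Prime T →
      ∀ (D : Type) [AddCommGroup D] [Module Λ D] [TopologicalSpace D] [DiscreteTopology D]
        [ContinuousSMul Λ D] (ρ : ContinuousRep Γ Λ D),
        (∀ d : D, ∃ n : ℕ, (p ^ n : ℤ) • d = 0) → Module.Finite Λ (CharacterModule D) →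
        ∃ (D' : Type) (_ : AddCommGroup D') (_ : Module (Λ ⧸ Ideal.span {T}) D')
          (_ : TopologicalSpace D') (_ : DiscreteTopology D')
          (_ : ContinuousSMul (Λ ⧸ Ideal.span {T}) D') (ρ' : ContinuousRep Γ (Λ ⧸ Ideal.span {T}) D'),
          (∀ d : D', ∃ n : ℕ, (p ^ n : ℤ) • d = 0) ∧
          Module.Finite (Λ ⧸ Ideal.span {T}) (CharacterModule D') ∧
          ((Module.finrank Λ (CharacterModule (ρ.H 0)) : ℤ) -
              Module.finrank Λ (CharacterModule (ρ.H 1)) +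
              Module.finrank Λ (CharacterModule (ρ.H 2)) =
            (Module.finrank (Λ ⧸ Ideal.span {T}) (CharacterModule (ρ'.H 0)) : ℤ) -
              Module.finrank (Λ ⧸ Ideal.span {T}) (CharacterModule (ρ'.H 1)) +
              Module.finrank (Λ ⧸ Ideal.span {T}) (CharacterModule (ρ'.H 2))) ∧
          Module.finrank Λ (CharacterModule D) =
            Module.finrank (Λ ⧸ Ideal.span {T}) (CharacterModule D'))
    (hFin : ∀ (R : Type) [CommRing R] [TopologicalSpace R] (A : Type) [AddCommGroup A] [Module R A]
      [TopologicalSpace A] [DiscreteTopology A] [ContinuousSMul R A] [Finite A]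
      (τ : ContinuousRep Γ R A), (∀ a : A, (p : R) • a = 0) → ∀ n : ℕ, Finite (τ.H n))
    (hEuler : ∀ (R : Type) [CommRing R] [TopologicalSpace R] (A : Type) [AddCommGroup A]
      [Module R A] [TopologicalSpace A] [DiscreteTopology A] [ContinuousSMul R A] [Finite A]
      (τ : ContinuousRep Γ R A), (∀ a : A, (p : R) • a = 0) →
        Nat.card (τ.H 0) * Nat.card (τ.H 2) * Nat.card A ^ c = Nat.card (τ.H 1))
    (m : ℕ) :
    ∀ (Λ : Type) [CommRing Λ] [TopologicalSpace Λ] [IsTopologicalRing Λ],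
      (Λ ≃+* MvPowerSeries (Fin m) ℤ_[p]) →
      ∀ (D : Type) [AddCommGroup D] [Module Λ D] [TopologicalSpace D] [DiscreteTopology D]
        [ContinuousSMul Λ D] (ρ : ContinuousRep Γ Λ D),
        (∀ d : D, ∃ n : ℕ, (p ^ n : ℤ) • d = 0) → Module.Finite Λ (CharacterModule D) →
        (Module.finrank Λ (CharacterModule (ρ.H 0)) : ℤ) -
            Module.finrank Λ (CharacterModule (ρ.H 1)) +
            Module.finrank Λ (CharacterModule (ρ.H 2)) =
          -((c : ℤ) * Module.finrank Λ (CharacterModule D)) := by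
  induction m with
  | zero =>
      intro Λ _ _ _ e D _ _ _ _ _ ρ hpD hD
      obtain ⟨hp0, hpr, hfield, hfin⟩ :=
        prime_natCast_and_isField_quotient_of_ringEquiv_mvPowerSeries_zero p e
      obtain ⟨D', _, _, _, _, _, ρ', hpD', hD', hχ, hrk⟩ := hstep 0 Λ e (p : Λ) hp0 hpr D ρ hpD hD
      haveI := hfin
      have hpk : ((p : ℕ) : Λ ⧸ Ideal.span {(p : Λ)}) = 0 := by
        rw [← map_natCast (Ideal.Quotient.mk (Ideal.span {(p : Λ)})), Ideal.Quotient.eq_zero_iff_mem]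
        exact Ideal.subset_span rfl
      rw [hχ, hrk]
      exact euler_of_isField p c hfield hpk (hFin _) (hEuler _) ρ' hD'
  | succ m ih =>
      intro Λ _ _ _ e D _ _ _ _ _ ρ hpD hD
      obtain ⟨T, hT0, hTp, ⟨e'⟩⟩ := exists_prime_quotient_ringEquiv_mvPowerSeries p e
      obtain ⟨D', _, _, _, _, _, ρ', hpD', hD', hχ, hrk⟩ := hstep (m + 1) Λ e T hT0 hTp D ρ hpD hD
      rw [hχ, hrk]
      exact ih (Λ ⧸ Ideal.span {T}) e' D' ρ' hpD' hD'

/-- **The same in the currency of the named facts** (`Greenberg2016.HasCorank`,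
`IsCofinitelyGenerated`): for every `Λ` with `Nonempty (Λ ≃+* ℤ_p⟦T₁,…,T_m⟧)`, every discrete
`p`-primary cofinitely generated `Λ[Γ]`-module `𝒟` and ALL corank witnesses `m', h₀, h₁, h₂` of
`𝒟, H⁰(Γ,𝒟), H¹(Γ,𝒟), H²(Γ,𝒟)`: `h₀ − h₁ + h₂ = −c·m'` — the common shape of
`prop41_globalEulerPoincareCorank` (`c = r₂`) and `prop42_localEulerPoincareCorank`
(`c = [K_v:ℚ_p]` / `0`). [cite: Greenberg2006, §4 A Props. 4.1, 4.2 (p. 367 L40 – p. 368 L22)] -/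
theorem corankEuler_of_step_of_finiteEuler
    (hstep : ∀ (j : ℕ) (Λ : Type) [CommRing Λ] [TopologicalSpace Λ] [IsTopologicalRing Λ],
      (Λ ≃+* MvPowerSeries (Fin j) ℤ_[p]) → ∀ (T : Λ), T ≠ 0 → Prime T →
      ∀ (D : Type) [AddCommGroup D] [Module Λ D] [TopologicalSpace D] [DiscreteTopology D]
        [ContinuousSMul Λ D] (ρ : ContinuousRep Γ Λ D),
        (∀ d : D, ∃ n : ℕ, (p ^ n : ℤ) • d = 0) → Module.Finite Λ (CharacterModule D) →
        ∃ (D' : Type) (_ : AddCommGroup D') (_ : Module (Λ ⧸ Ideal.span {T}) D')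
          (_ : TopologicalSpace D') (_ : DiscreteTopology D')
          (_ : ContinuousSMul (Λ ⧸ Ideal.span {T}) D') (ρ' : ContinuousRep Γ (Λ ⧸ Ideal.span {T}) D'),
          (∀ d : D', ∃ n : ℕ, (p ^ n : ℤ) • d = 0) ∧
          Module.Finite (Λ ⧸ Ideal.span {T}) (CharacterModule D') ∧
          ((Module.finrank Λ (CharacterModule (ρ.H 0)) : ℤ) -
              Module.finrank Λ (CharacterModule (ρ.H 1)) +
              Module.finrank Λ (CharacterModule (ρ.H 2)) =
            (Module.finrank (Λ ⧸ Ideal.span {T}) (CharacterModule (ρ'.H 0)) : ℤ) -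
              Module.finrank (Λ ⧸ Ideal.span {T}) (CharacterModule (ρ'.H 1)) +
              Module.finrank (Λ ⧸ Ideal.span {T}) (CharacterModule (ρ'.H 2))) ∧
          Module.finrank Λ (CharacterModule D) =
            Module.finrank (Λ ⧸ Ideal.span {T}) (CharacterModule D'))
    (hFin : ∀ (R : Type) [CommRing R] [TopologicalSpace R] (A : Type) [AddCommGroup A] [Module R A]
      [TopologicalSpace A] [DiscreteTopology A] [ContinuousSMul R A] [Finite A]
      (τ : ContinuousRep Γ R A), (∀ a : A, (p : R) • a = 0) → ∀ n : ℕ, Finite (τ.H n))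
    (hEuler : ∀ (R : Type) [CommRing R] [TopologicalSpace R] (A : Type) [AddCommGroup A]
      [Module R A] [TopologicalSpace A] [DiscreteTopology A] [ContinuousSMul R A] [Finite A]
      (τ : ContinuousRep Γ R A), (∀ a : A, (p : R) • a = 0) →
        Nat.card (τ.H 0) * Nat.card (τ.H 2) * Nat.card A ^ c = Nat.card (τ.H 1))
    {m : ℕ} {Λ : Type} [CommRing Λ] [TopologicalSpace Λ] [IsTopologicalRing Λ]
    (hΛ : Nonempty (Λ ≃+* MvPowerSeries (Fin m) ℤ_[p]))
    {D : Type} [AddCommGroup D] [Module Λ D] [TopologicalSpace D] [DiscreteTopology D]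
    [ContinuousSMul Λ D] (ρ : ContinuousRep Γ Λ D)
    (hpD : ∀ d : D, ∃ n : ℕ, (p ^ n : ℤ) • d = 0) (hD : IsCofinitelyGenerated Λ D)
    {m' h₀ h₁ h₂ : ℕ} (hm' : HasCorank Λ D m') (hh₀ : HasCorank Λ (ρ.H 0) h₀)
    (hh₁ : HasCorank Λ (ρ.H 1) h₁) (hh₂ : HasCorank Λ (ρ.H 2) h₂) :
    (h₀ : ℤ) - h₁ + h₂ = -((c : ℤ) * m') := by
  obtain ⟨e⟩ := hΛ
  have hD' : Module.Finite Λ (CharacterModule D) :=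
    isCofinitelyGenerated_iff_module_finite_characterModule.1 hD
  have key := finrank_euler_of_step_of_finiteEuler p c hstep hFin hEuler m Λ e D ρ hpD hD'
  rw [hm' _ _ (isDualPairing_characterModule Λ D), hh₀ _ _ (isDualPairing_characterModule Λ _),
    hh₁ _ _ (isDualPairing_characterModule Λ _), hh₂ _ _ (isDualPairing_characterModule Λ _)] at key
  exact key

end Induction

end Literature.NumberTheory.IwasawaTheory.Greenberg2006

end
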